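import Literature.Analysis.Toeplitz.BernsteinSzegoSections
import HarnessLib

/-!
# Bernstein–Szegő sections below the threshold: no short section is exact

Topic `Analysis/Toeplitz`, namespace `Literature.Analysis.Toeplitz.BernsteinSzego`; continuation of
`BernsteinSzegoSections.lean` (same objects: `IsBSMoment`, `gram`, `moment`, `mulMod`, `placePoly`).
**Proof file**: theorems and plumbing definitions only — 0 named facts, no `sorry`; finite algebra over a
commutative ring.

## Statement

`BernsteinSzegoSections.lean` proves the "if" half of the finite-section exactness of a Bernstein–Szegő
Toeplitz form ([Szego1975, §11.2 Thm 11.2]: `φ_n = z^{n−σ}h^*` for `n ≥ σ`; consequence via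
[Szego1975, §11.4 Thm 11.4.2]): for `n ≥ σ = deg h` the traces `Tr(G_n⁻¹ T^{(l)}_n)` of the compressed
shifts equal the power sums of the roots of `h^*` for every `l`.  This file proves the CONVERSE
(`exists_shift_trace_ne`): if `h` has precise degree `σ` (`m(0) ≠ 0` for `m = h^*`), then for every
`n < σ` some shift `1 ≤ l ≤ σ` has `Tr(G_n⁻¹ T^{(l)}_n) ≠ Tr(G_σ⁻¹ T^{(l)}_σ)` (= the exact value), provided
`(σ − n)·m(0) ≠ 0` in `R` and `G_n, G_σ, G_{2σ+1}` are invertible (in the positive-definite case all are).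
In OPUC language: a Bernstein–Szegő weight of precise degree `σ` has its last non-zero Verblunsky
coefficient at index `σ − 1` (`φ_σ(0) = \bar h_σ ≠ 0` in the recurrences [Szego1975, (11.4.6)–(11.4.7)]), so
no shorter section reproduces all the moments' power sums.  The converse is not printed in [Szego1975] in
this form; it is derived here (and is the "only if" of the threshold law recorded for Connes' semilocal
cutoff on `𝔽_q(T)` in the module docstring of `BernsteinSzegoSections.lean`).

## Proof (algebraic degree count)

Write `L(z^k) := c(k)` on Laurent polynomials, `K_A(z) := Σ_{a,b<n} A_{ba} z^{a−b}` for an `n × n` matrix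
`A`, so that `L(K_A z^{−l}) = Tr(A T^{(l)}_n)` (`lpair_diagVec`), and `|h|²(z) := Σ_{j,j'} m_j m_{j'} z^{j'−j}`,
for which the moment recursion gives `L(|h|² z^{−l}) = [l = 0]` for all `l ∈ ℤ` (`lpair_hsqVec`).  If level
`n < σ` agreed with level `σ` at every shift `1 ≤ l ≤ σ` (hence, by evenness/transposition, at every
`|l| ≤ σ`, and at `l = 0` both give the dimensions `n`, `σ`), then
`E := K_{G_σ⁻¹} − K_{G_n⁻¹} − (σ − n)|h|²` — a Laurent polynomial supported in `[−σ, σ]` — would satisfy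
`L(E z^{−l}) = 0` for all `|l| ≤ σ`, i.e. its coefficient vector lies in the kernel of `G_{2σ+1}`; so
`E = 0`.  But the coefficient of `z^σ` in `E` is `−(σ − n) m_0 m_σ = −(σ − n) m(0) ≠ 0` (`K_A` has degree
`< n ≤ σ`).  Contradiction.

## Main statements

* `exists_shift_trace_ne` — the converse as above (general monic `m`, any commutative ring).
* `exists_shift_trace_ne_trace_mulMod` — the same against the exact value `Tr (mulMod X^l m)`.
* `exists_shift_trace_ne_powerSum` — for `h_S = ∏_v (1 − κ_v z^{d_v})`, all `κ_v ≠ 0`, `R` a domain of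
  characteristic `0`: for `n < Σ d_v` some `1 ≤ l ≤ Σ d_v` has
  `Tr(G_n⁻¹ T^{(l)}_n) ≠ Σ_{v : d_v ∣ l} d_v κ_v^{l/d_v}`.
* `exists_shift_trace_ne_functionField` — `κ_v = q^{−d_v/2}`: `≠ q^{−l/2} Σ_{v : d_v ∣ l} d_v`.  With
  `trace_section_functionField` this is the full threshold statement "exact for all `l` iff `n ≥ deg S`"
  in the Toeplitz model (interpretation for Connes 1999 §VIII: see `BernsteinSzegoSections.lean`; not
  formalised).

## References

* [Szego1975] G. Szegő, *Orthogonal Polynomials*, AMS Colloquium Publications 23, 4th ed. (1975), §11.2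
  Theorem 11.2 (11.2.2); §11.4 Theorem 11.4.2 (11.4.5), recurrences (11.4.6)–(11.4.7) (read at page).
* [Connes1999] A. Connes, Selecta Math. (N.S.) 5 (1999) 29–106, §VIII (context only).
-/

noncomputable section

open Polynomial Finset
open scoped Polynomial BigOperators

namespace Literature.Analysis.Toeplitz.BernsteinSzego

variable {R : Type*} [CommRing R]

section Threshold

variable {m : R[X]} {c : ℤ → R}

/-- The `ℤ`-shifted moment matrix `T^{(l)}_n = (c(a − b − l))_{a,b<n}` for `l ∈ ℤ`; for `l ≥ 0` this is
`moment c n l` (shift `z^l`), for `l < 0` it is the matrix of the adjoint shift. [folklore] -/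
def momentZ (c : ℤ → R) (n : ℕ) (l : ℤ) : Matrix (Fin n) (Fin n) R :=
  Matrix.of fun a b => c ((a : ℤ) - (b : ℕ) - l)

omit [CommRing R] in
/-- `momentZ` at a natural shift is `moment`. [folklore] -/
private theorem momentZ_natCast (c : ℤ → R) (n l : ℕ) : momentZ c n (l : ℤ) = moment c n l := rfl

omit [CommRing R] in
/-- `momentZ c n 0 = gram c n`. [folklore] -/
private theorem momentZ_zero (c : ℤ → R) (n : ℕ) : momentZ c n 0 = gram c n := by
  ext a b; simp [momentZ, gram, sub_zero]

omit [CommRing R] in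
/-- For an even sequence, the negative shift is the transpose. [folklore] -/
private theorem momentZ_neg (heven : ∀ k, c (-k) = c k) (n : ℕ) (l : ℤ) :
    momentZ c n (-l) = (momentZ c n l).transpose := by
  ext a b
  simp only [momentZ, Matrix.of_apply, Matrix.transpose_apply]
  rw [← heven]; congr 1; ring

omit [CommRing R] in
/-- The Gram matrix of an even sequence is symmetric. [folklore] -/
private theorem gram_transpose (heven : ∀ k, c (-k) = c k) (n : ℕ) : (gram c n).transpose = gram c n := by
  ext a b
  simp only [gram, Matrix.of_apply, Matrix.transpose_apply]
  rw [← heven]; congr 1; ring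

/-- **Negative shifts.** `Tr(G_n⁻¹ T^{(−l)}_n) = Tr(G_n⁻¹ T^{(l)}_n)` (even `c`, `G_n` invertible): the compression
of the adjoint shift has the same trace. [folklore] -/
private theorem trace_invOf_gram_mul_momentZ_neg (heven : ∀ k, c (-k) = c k) (n : ℕ) (l : ℤ)
    [Invertible (gram c n)] :
    Matrix.trace (⅟(gram c n) * momentZ c n (-l)) = Matrix.trace (⅟(gram c n) * momentZ c n l) := by
  have hsym : (⅟(gram c n)).transpose = ⅟(gram c n) := by
    rw [Matrix.invOf_eq_nonsing_inv, Matrix.transpose_nonsing_inv, gram_transpose heven]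
  rw [momentZ_neg heven, ← Matrix.trace_transpose, Matrix.transpose_mul, Matrix.transpose_transpose,
    hsym, Matrix.trace_mul_comm]

/-- Pairing of an exponent vector `v` on the window `[−σ, σ]` (index `x` ↦ exponent `x − σ`) with the
shift `l`: `Σ_x v_x c(x − σ − l)` = "`L(E z^{−l})`" for `E = Σ_x v_x z^{x−σ}` and `L(z^k) := c(k)`. [folklore] -/
def lpair (c : ℤ → R) (σ : ℕ) (v : Fin (2 * σ + 1) → R) (l : ℤ) : R :=
  ∑ x, v x * c ((x : ℤ) - σ - l)

/-- `lpair` at the shift `y − σ` is the `y`-th entry of `v ᵥ* G_{2σ+1}`. [folklore] -/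
private theorem lpair_eq_vecMul (c : ℤ → R) (σ : ℕ) (v : Fin (2 * σ + 1) → R) (y : Fin (2 * σ + 1)) :
    lpair c σ v ((y : ℤ) - σ) = Matrix.vecMul v (gram c (2 * σ + 1)) y := by
  simp only [lpair, Matrix.vecMul, dotProduct, gram, Matrix.of_apply]
  refine sum_congr rfl fun x _ => ?_
  congr 2; ring

/-- If `G_{2σ+1}` is invertible, a window vector all of whose pairings with `|l| ≤ σ` vanish is zero
("a trigonometric polynomial of degree `≤ σ` whose product with `f` has vanishing Fourier coefficients of
order `≤ σ` vanishes"). [folklore] -/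
private theorem eq_zero_of_lpair_eq_zero (c : ℤ → R) (σ : ℕ) (v : Fin (2 * σ + 1) → R)
    [Invertible (gram c (2 * σ + 1))]
    (h : ∀ l : ℤ, -(σ : ℤ) ≤ l → l ≤ σ → lpair c σ v l = 0) : v = 0 := by
  have hv : Matrix.vecMul v (gram c (2 * σ + 1)) = 0 := by
    ext y
    rw [← lpair_eq_vecMul, Pi.zero_apply]
    exact h _ (by omega) (by have := y.2; omega)
  calc v = Matrix.vecMul (Matrix.vecMul v (gram c (2 * σ + 1))) (⅟(gram c (2 * σ + 1))) := by
        rw [Matrix.vecMul_vecMul, mul_invOf_self, Matrix.vecMul_one]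
    _ = 0 := by rw [hv, Matrix.zero_vecMul]

/-- Diagonal sums of an `n × n` matrix as an exponent vector on `[−σ, σ]` (`n ≤ σ + 1`):
`x ↦ Σ_{a − b = x − σ} A_{ba}` — the coefficients of `K_A(z) = Σ_{a,b} A_{ba} z^{a−b}`
(for `A = G_n⁻¹`: the reproducing kernel of `𝒫_{n−1}` on the diagonal, times `f`'s inverse role). [folklore] -/
def diagVec {n : ℕ} (A : Matrix (Fin n) (Fin n) R) (σ : ℕ) : Fin (2 * σ + 1) → R :=
  fun x => ∑ a : Fin n, ∑ b : Fin n, if (x : ℕ) + b = a + σ then A b a else 0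

/-- `L(K_A z^{−l}) = Tr(A T^{(l)}_n)`. [folklore] -/
private theorem lpair_diagVec {n σ : ℕ} (hn : n ≤ σ + 1) (A : Matrix (Fin n) (Fin n) R) (l : ℤ) :
    lpair c σ (diagVec A σ) l = Matrix.trace (A * momentZ c n l) := by
  have rhs : Matrix.trace (A * momentZ c n l) =
      ∑ a : Fin n, ∑ b : Fin n, A b a * c ((a : ℤ) - (b : ℕ) - l) := by
    simp only [Matrix.trace, Matrix.diag_apply, Matrix.mul_apply, momentZ, Matrix.of_apply]
    rw [sum_comm]
  rw [rhs]
  simp only [lpair, diagVec, sum_mul]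
  rw [sum_comm]
  refine sum_congr rfl fun a _ => ?_
  rw [sum_comm]
  refine sum_congr rfl fun b _ => ?_
  have hlt : (a : ℕ) + σ - b < 2 * σ + 1 := by have := a.2; have := b.2; omega
  have hb : (b : ℕ) ≤ a + σ := by have := b.2; omega
  rw [Fintype.sum_eq_single (⟨(a : ℕ) + σ - b, hlt⟩ : Fin (2 * σ + 1))]
  · rw [if_pos (by dsimp only; omega)]
    congr 2
    dsimp only
    rw [Nat.cast_sub hb, Nat.cast_add]
    ring
  · intro x hx
    rw [if_neg, zero_mul]
    intro hxe
    apply hx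
    ext; dsimp only; omega

/-- The top exponent `σ` is not reached by `K_A` when `n ≤ σ`. [folklore] -/
private theorem diagVec_top {n σ : ℕ} (hn : n ≤ σ) (A : Matrix (Fin n) (Fin n) R) :
    diagVec A σ ⟨2 * σ, by omega⟩ = 0 := by
  simp only [diagVec]
  refine sum_eq_zero fun a _ => sum_eq_zero fun b _ => ?_
  rw [if_neg]
  have := a.2; omega

/-- The exponent vector of `|h|² = Σ_{j,j'} m_j m_{j'} z^{j'−j}` (`h_i = m_{σ−i}`) on `[−σ, σ]`. [folklore] -/
def hsqVec (m : R[X]) (σ : ℕ) : Fin (2 * σ + 1) → R :=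
  fun x => ∑ j ∈ range (σ + 1), ∑ j' ∈ range (σ + 1),
    if (x : ℕ) + j = j' + σ then m.coeff j * m.coeff j' else 0

/-- `L(|h|² z^{−l}) = [l = 0]` for every `l ∈ ℤ`: the two-sided form of the moment recursion
(`f·|h|² ≡ 1`). [cite: Szego1975, §11.2 Thm 11.2 eq. (11.2.2)] -/
theorem lpair_hsqVec (h : IsBSMoment m c) (hm : m.Monic) {σ : ℕ} (hσ : m.natDegree = σ) (l : ℤ) :
    lpair c σ (hsqVec m σ) l = if l = 0 then 1 else 0 := by
  have hrec : ∀ t : ℤ, -(σ : ℤ) < t → ∑ j ∈ range (σ + 1), m.coeff j * c (t + j) = 0 := by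
    intro t ht; have := h.recur t (by rw [hσ]; exact ht); rwa [hσ] at this
  have hnorm : ∑ j ∈ range (σ + 1), m.coeff j * c (-(σ : ℤ) + j) = 1 := by
    have := h.norm; rwa [hσ] at this
  -- expand the pairing as a double sum over (j, j')
  have expand : lpair c σ (hsqVec m σ) l =
      ∑ j ∈ range (σ + 1), ∑ j' ∈ range (σ + 1), m.coeff j * m.coeff j' * c ((j' : ℤ) - j - l) := by
    simp only [lpair, hsqVec, sum_mul]
    rw [sum_comm]
    refine sum_congr rfl fun j hj => ?_
    rw [sum_comm]
    refine sum_congr rfl fun j' hj' => ?_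
    rw [mem_range] at hj hj'
    have hlt : j' + σ - j < 2 * σ + 1 := by omega
    rw [Fintype.sum_eq_single (⟨j' + σ - j, hlt⟩ : Fin (2 * σ + 1))]
    · rw [if_pos (by dsimp only; omega)]
      congr 1
      have hj2 : j ≤ j' + σ := by omega
      dsimp only
      rw [Nat.cast_sub hj2, Nat.cast_add]
      ring
    · intro x hx
      rw [if_neg, zero_mul]
      intro hxe; apply hx; ext; dsimp only; omega
  rw [expand]
  rcases le_or_gt l 0 with hl | hl
  · -- `l ≤ 0`: sum over `j'` first; recursion at `t = -j - l ≥ -σ`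
    have inner : ∀ j ∈ range (σ + 1),
        ∑ j' ∈ range (σ + 1), m.coeff j * m.coeff j' * c ((j' : ℤ) - j - l) =
          m.coeff j * if (j : ℤ) = σ - l then 1 else 0 := by
      intro j hj
      rw [mem_range] at hj
      have e1 : ∑ j' ∈ range (σ + 1), m.coeff j * m.coeff j' * c ((j' : ℤ) - j - l) =
          m.coeff j * ∑ j' ∈ range (σ + 1), m.coeff j' * c ((-(j : ℤ) - l) + j') := by
        rw [mul_sum]
        refine sum_congr rfl fun j' _ => ?_
        rw [mul_assoc, show ((j' : ℤ) - j - l) = (-(j : ℤ) - l) + j' by ring]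
      rw [e1]
      congr 1
      by_cases hjl : (j : ℤ) = σ - l
      · rw [if_pos hjl, show (-(j : ℤ) - l) = -(σ : ℤ) by omega]
        exact hnorm
      · rw [if_neg hjl]
        exact hrec _ (by omega)
    rw [sum_congr rfl inner]
    by_cases hl0 : l = 0
    · subst hl0
      have hmσ : m.coeff σ = 1 := by rw [← hσ]; exact hm.coeff_natDegree
      rw [if_pos rfl, Finset.sum_eq_single σ]
      · rw [if_pos (by simp), mul_one, hmσ]
      · intro j _ hne
        rw [if_neg (by rw [sub_zero]; exact_mod_cast hne), mul_zero]
      · intro hσmem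
        exact absurd (mem_range.2 (Nat.lt_succ_self σ)) hσmem
    · rw [if_neg hl0]
      refine sum_eq_zero fun j hj => ?_
      rw [mem_range] at hj
      rw [if_neg (by omega), mul_zero]
  · -- `l > 0`: sum over `j` first; recursion at `t = l - j' > -σ`
    rw [if_neg (by omega), sum_comm]
    refine sum_eq_zero fun j' hj' => ?_
    rw [mem_range] at hj'
    have e1 : ∑ j ∈ range (σ + 1), m.coeff j * m.coeff j' * c ((j' : ℤ) - j - l) =
        m.coeff j' * ∑ j ∈ range (σ + 1), m.coeff j * c (((l : ℤ) - j') + j) := by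
      rw [mul_sum]
      refine sum_congr rfl fun j _ => ?_
      rw [← h.even ((j' : ℤ) - j - l), show -((j' : ℤ) - j - l) = ((l : ℤ) - j') + j by ring]
      ring
    rw [e1, hrec _ (by omega), mul_zero]

/-- The top exponent `σ` of `|h|²` carries the coefficient `h_σ \bar h_0 = m_0 · m_σ`. [folklore] -/
private theorem hsqVec_top (m : R[X]) (σ : ℕ) :
    hsqVec m σ ⟨2 * σ, by omega⟩ = m.coeff 0 * m.coeff σ := by
  simp only [hsqVec]
  rw [Finset.sum_eq_single 0, Finset.sum_eq_single σ]
  · rw [if_pos (by omega)]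
  · intro j' hj' hne
    rw [mem_range] at hj'
    rw [if_neg (by omega)]
  · intro hmem; exact absurd (mem_range.2 (Nat.lt_succ_self σ)) hmem
  · intro j hj hne
    rw [mem_range] at hj
    refine sum_eq_zero fun j' hj' => ?_
    rw [mem_range] at hj'
    rw [if_neg (by omega)]
  · intro hmem; exact absurd (mem_range.2 (Nat.succ_pos σ)) hmem

/-- `lpair` is linear in the window vector (the combination used below). [folklore] -/
private theorem lpair_sub_sub_smul (c : ℤ → R) (σ : ℕ) (v₁ v₂ v₃ : Fin (2 * σ + 1) → R) (r : R) (l : ℤ) :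
    lpair c σ (v₁ - v₂ - r • v₃) l = lpair c σ v₁ l - lpair c σ v₂ l - r * lpair c σ v₃ l := by
  simp only [lpair, Pi.sub_apply, Pi.smul_apply, smul_eq_mul, sub_mul, mul_assoc, sum_sub_distrib,
    mul_sum]

/-- **Below the threshold no finite section is exact (part (b)).**  Let `c` be a Bernstein–Szegő moment
sequence of the monic `m = h^*` of degree `σ` with `m(0) ≠ 0` (i.e. `h` of precise degree `σ`), and let
`n < σ` with `(σ − n)·m(0) ≠ 0` in `R` and `G_n, G_σ, G_{2σ+1}` invertible.  Then some shift `1 ≤ l ≤ σ` has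
`Tr(G_n⁻¹ T^{(l)}_n) ≠ Tr(G_σ⁻¹ T^{(l)}_σ)` (the latter = the exact value, `trace_invOf_gram_mul_moment` /
`trace_section`).  Proof (algebraic form of the degree count): if all shifts `|l| ≤ σ` agreed, the
exponent vector of `K_σ − K_n − (σ−n)|h|²` (degree `≤ σ`, top coefficient `−(σ−n) m_0 ≠ 0`) would pair to
zero with every `|l| ≤ σ`, i.e. lie in the kernel of `G_{2σ+1}`.  In OPUC terms: the last non-vanishing
Verblunsky coefficient of a Bernstein–Szegő weight of precise degree `σ` sits at index `σ − 1`
(`φ_σ(0) = \bar h_σ ≠ 0` in (11.4.6)–(11.4.7)), so no shorter section reproduces the power sums.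
[cite: Szego1975, §11.2 Thm 11.2 + §11.4 eqs. (11.4.5)–(11.4.7) (converse direction; consequence)] -/
theorem exists_shift_trace_ne (h : IsBSMoment m c) (hm : m.Monic) {σ : ℕ} (hσ : m.natDegree = σ)
    {n : ℕ} (hn : n < σ) (hR : ((σ - n : ℕ) : R) * m.coeff 0 ≠ 0)
    [Invertible (gram c n)] [Invertible (gram c σ)] [Invertible (gram c (2 * σ + 1))] :
    ∃ l : ℕ, 1 ≤ l ∧ l ≤ σ ∧
      Matrix.trace (⅟(gram c n) * moment c n l) ≠ Matrix.trace (⅟(gram c σ) * moment c σ l) := by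
  by_contra hall
  simp only [not_exists, not_and, ne_eq, not_not] at hall
  set v : Fin (2 * σ + 1) → R :=
    diagVec (⅟(gram c σ)) σ - diagVec (⅟(gram c n)) σ - ((σ - n : ℕ) : R) • hsqVec m σ with hv_def
  have hv : ∀ l : ℤ, -(σ : ℤ) ≤ l → l ≤ σ → lpair c σ v l = 0 := by
    intro l hl1 hl2
    rw [hv_def, lpair_sub_sub_smul, lpair_diagVec (Nat.le_succ σ), lpair_diagVec (by omega),
      lpair_hsqVec h hm hσ]
    rcases lt_trichotomy l 0 with hneg | rfl | hpos
    · obtain ⟨k, rfl⟩ : ∃ k : ℕ, l = -(k : ℤ) := ⟨l.natAbs, by omega⟩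
      rw [trace_invOf_gram_mul_momentZ_neg h.even, trace_invOf_gram_mul_momentZ_neg h.even,
        momentZ_natCast, momentZ_natCast, hall k (by omega) (by omega), if_neg (by omega)]
      ring
    · rw [momentZ_zero, momentZ_zero, invOf_mul_self, invOf_mul_self, Matrix.trace_one,
        Matrix.trace_one, Fintype.card_fin, Fintype.card_fin, if_pos rfl, Nat.cast_sub hn.le]
      ring
    · obtain ⟨k, rfl⟩ : ∃ k : ℕ, l = (k : ℤ) := ⟨l.toNat, by omega⟩
      rw [momentZ_natCast, momentZ_natCast, hall k (by omega) (by omega), if_neg (by omega)]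
      ring
  have hv0 : v = 0 := eq_zero_of_lpair_eq_zero c σ v hv
  have hmσ : m.coeff σ = 1 := by rw [← hσ]; exact hm.coeff_natDegree
  have htop : v ⟨2 * σ, by omega⟩ = -(((σ - n : ℕ) : R) * m.coeff 0) := by
    rw [hv_def, Pi.sub_apply, Pi.sub_apply, Pi.smul_apply, smul_eq_mul, diagVec_top le_rfl,
      diagVec_top hn.le, hsqVec_top, hmσ]
    ring
  rw [hv0, Pi.zero_apply] at htop
  exact hR (neg_eq_zero.1 htop.symm)

/-- Part (b) against the exact value: for `n < σ` some `1 ≤ l ≤ σ` has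
`Tr(G_n⁻¹ T^{(l)}_n) ≠ Tr (mulMod X^l m)` (the `l`-th power sum of the roots of `m = h^*`).
[cite: Szego1975, §11.2 Thm 11.2 + §11.4 eqs. (11.4.5)–(11.4.7) (converse direction; consequence)] -/
theorem exists_shift_trace_ne_trace_mulMod [Nontrivial R] (h : IsBSMoment m c) (hm : m.Monic) {σ : ℕ}
    (hσ : m.natDegree = σ) {n : ℕ} (hn : n < σ) (hR : ((σ - n : ℕ) : R) * m.coeff 0 ≠ 0)
    [Invertible (gram c n)] [Invertible (gram c σ)] [Invertible (gram c (2 * σ + 1))]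
    (hM : (X ^ (σ - m.natDegree) * m).Monic) (hMn : (X ^ (σ - m.natDegree) * m).natDegree = σ) :
    ∃ l : ℕ, 1 ≤ l ∧ l ≤ σ ∧
      Matrix.trace (⅟(gram c n) * moment c n l) ≠ LinearMap.trace R _ (mulMod (X ^ l) hM hMn) := by
  obtain ⟨l, hl1, hl2, hne⟩ := exists_shift_trace_ne h hm hσ hn hR
  refine ⟨l, hl1, hl2, ?_⟩
  rwa [trace_invOf_gram_mul_moment h (le_of_eq hσ) hM hMn l] at hne

variable {ι : Type*}

/-- bookkeeping: `placePoly` is monic (local copy). [folklore] -/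
private theorem monic_placePoly' (s : Finset ι) (d : ι → ℕ) (κ : ι → R)
    (hd : ∀ v, 0 < d v) : (placePoly s d κ).Monic :=
  monic_prod_of_monic _ _ fun v _ => monic_X_pow_sub_C (κ v) (hd v).ne'

/-- bookkeeping: `deg placePoly = Σ d_v` (local copy). [folklore] -/
private theorem natDegree_placePoly' [Nontrivial R] (s : Finset ι) (d : ι → ℕ) (κ : ι → R)
    (hd : ∀ v, 0 < d v) : (placePoly s d κ).natDegree = ∑ v ∈ s, d v := by
  rw [placePoly, natDegree_prod_of_monic _ _ fun v _ => monic_X_pow_sub_C (κ v) (hd v).ne']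
  exact sum_congr rfl fun v _ => natDegree_X_pow_sub_C

/-- bookkeeping: the constant coefficient of `placePoly` is `∏ (−κ_v)`, non-zero when all `κ_v ≠ 0`
(`R` a domain). [folklore] -/
private theorem coeff_zero_placePoly_ne_zero [IsDomain R] (s : Finset ι) (d : ι → ℕ) (κ : ι → R)
    (hd : ∀ v, 0 < d v) (hκ : ∀ v, κ v ≠ 0) : (placePoly s d κ).coeff 0 ≠ 0 := by
  rw [placePoly, coeff_zero_prod]
  refine prod_ne_zero_iff.2 fun v _ => ?_
  rw [coeff_sub, coeff_X_pow, if_neg (hd v).ne, coeff_C_zero, zero_sub, neg_ne_zero]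
  exact hκ v

/-- **Threshold law, converse, census form.** For `h_S = ∏_v (1 − κ_v z^{d_v})` with all `κ_v ≠ 0`
(`R` a domain of characteristic zero), a Bernstein–Szegő moment sequence `c` of `h_S^*`, and a level
`n < σ = Σ_v d_v` with `G_n, G_σ, G_{2σ+1}` invertible: some shift `1 ≤ l ≤ σ` has
`Tr(G_n⁻¹ T^{(l)}_n) ≠ Σ_{v : d_v ∣ l} d_v κ_v^{l/d_v}` — below the threshold the finite section does NOT
reproduce the power sums (the `S`-explicit formula), while above it does (`trace_section`).
[cite: Szego1975, §11.2 Thm 11.2 + §11.4 eqs. (11.4.5)–(11.4.7) (converse direction; consequence)] -/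
theorem exists_shift_trace_ne_powerSum [IsDomain R] [CharZero R] [DecidableEq ι] (s : Finset ι)
    (d : ι → ℕ) (κ : ι → R) (hd : ∀ v, 0 < d v) (hκ : ∀ v, κ v ≠ 0) {c : ℤ → R}
    (hc : IsBSMoment (placePoly s d κ) c) {n : ℕ} (hn : n < ∑ v ∈ s, d v)
    [Invertible (gram c n)] [Invertible (gram c (∑ v ∈ s, d v))]
    [Invertible (gram c (2 * ∑ v ∈ s, d v + 1))] :
    ∃ l : ℕ, 1 ≤ l ∧ l ≤ ∑ v ∈ s, d v ∧
      Matrix.trace (⅟(gram c n) * moment c n l) ≠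
        ∑ v ∈ s, if d v ∣ l then (d v : R) * κ v ^ (l / d v) else 0 := by
  obtain ⟨l, hl1, hl2, hne⟩ := exists_shift_trace_ne hc (monic_placePoly' s d κ hd)
    (natDegree_placePoly' s d κ hd) hn
    (mul_ne_zero (by rw [Nat.cast_ne_zero]; omega) (coeff_zero_placePoly_ne_zero s d κ hd hκ))
  refine ⟨l, hl1, hl2, ?_⟩
  rwa [trace_section_of_ne_zero s d κ hd hc le_rfl (by omega)] at hne

/-- **Threshold law, converse, `𝔽_q(T)` normalisation.** With `κ_v = q^{−d_v/2}` (`q > 0`): for every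
level `n < deg S = Σ_v d_v` (with the Gram matrices `G_n, G_σ, G_{2σ+1}` invertible — positive definite in
the application) some shift `1 ≤ l ≤ deg S` has `Tr(G_n⁻¹ T^{(l)}_n) ≠ q^{−l/2} Σ_{v : d_v ∣ l} d_v`.
Together with `trace_section_functionField`: the finite section is exact for all `l` iff `n ≥ deg S`.
[cite: Szego1975, §11.2 Thm 11.2 + §11.4 eqs. (11.4.5)–(11.4.7) (converse direction; consequence)] -/
theorem exists_shift_trace_ne_functionField (q : ℝ) (hq : 0 < q) [DecidableEq ι] (s : Finset ι)
    (d : ι → ℕ) (hd : ∀ v, 0 < d v) {c : ℤ → ℝ}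
    (hc : IsBSMoment (placePoly s d fun v => q ^ (-(d v : ℝ) / 2)) c) {n : ℕ} (hn : n < ∑ v ∈ s, d v)
    [Invertible (gram c n)] [Invertible (gram c (∑ v ∈ s, d v))]
    [Invertible (gram c (2 * ∑ v ∈ s, d v + 1))] :
    ∃ l : ℕ, 1 ≤ l ∧ l ≤ ∑ v ∈ s, d v ∧
      Matrix.trace (⅟(gram c n) * moment c n l) ≠ q ^ (-(l : ℝ) / 2) * ∑ v ∈ s with d v ∣ l, (d v : ℝ) := by
  obtain ⟨l, hl1, hl2, hne⟩ := exists_shift_trace_ne hc (monic_placePoly' s d _ hd)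
    (natDegree_placePoly' s d _ hd) hn
    (mul_ne_zero (by rw [Nat.cast_ne_zero]; omega) (coeff_zero_placePoly_ne_zero s d _ hd
      (fun v => (Real.rpow_pos_of_pos hq _).ne')))
  refine ⟨l, hl1, hl2, ?_⟩
  rwa [trace_section_functionField q hq s d hd hc le_rfl (by omega)] at hne

end Threshold

end Literature.Analysis.Toeplitz.BernsteinSzego
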